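import Literature.Computability.Complexity.StackMachinesTM2
import Literature.Computability.Complexity.StackLists
import HarnessLib

/-!
# The pair former `b :: st ↦ boolPair st [b]` as one `TM2` machine (stub `stub_pairFormer`, line `birth`)

Crux `UniformStreamLB` (stmt-PneNP-16045), line `birth`: the streaming update machine `M₁` reads the
tree's pairing `boolPair st [b] = dbl st ++ [false, true, b]` of the current state `st` and the next
input bit `b`, while the streaming loop can only push the raw bit on top of the state (`b :: st`).
This file supplies ONE Mathlib `TM2` machine (bundled `Turing.TM2ComputableAux Bool Bool`) doing the
reformatting `b :: st ↦ boolPair st [b]` within `8 · |st| + 8` steps.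

Construction: a structured stack program (`Com (Fin 3)`, `StackPrograms.lean`) over three registers
`0` (input), `1` (scratch), `2` (output): pop the bit `b` off register `0` and push `b`, `true`,
`false` on register `2` (which then holds `[false, true, b]`); pour register `0` onto register `1`
(which then holds `st.reverse`); loop over register `1` pushing every popped bit twice on register
`2` (which then holds `dbl st ++ [false, true, b] = boolPair st [b]`, registers `0`, `1` empty);
cost `7 · |st| + 7` in the exact cost semantics (`Com.Runs`), compiled to `TM2` step for step by
`Com.outputsWithin_of_runs_equiv` (`StackMachinesTM2.lean`). Register files are written as vectors
`![r₀, r₁, r₂]`.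

## References

* S. Arora, B. Barak, *Computational Complexity: A Modern Approach*, CUP 2009, §0.1 (pairing of
  strings), §1.2–1.3 (multi-tape machines, running time). [Arora–Barak 2009, §0.1, §1.3]
* M. L. Minsky, *Computation: Finite and Infinite Machines*, Prentice-Hall 1967, §11.1, §14.1
  (program machines with push-down registers), through `StackMachinesTM2.lean`.
-/

set_option linter.dupNamespace false -- `Summit.PneNP.PneNP.…`: summit = sub-problem name

namespace Summit.PneNP.PneNP.Theorems.UniformStreamLB.Birth

open Literature.Computability.Complexity Literature.Computability.Complexity.Com

namespace PairFormer

/-! ### Register files over `Fin 3` as vectors -/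

section FileLemmas

variable (i t o v : List Bool)

/-- Writing register `0`. [folklore] -/
@[simp] theorem update_vec_zero :
    Function.update (![i, t, o] : Regs (Fin 3)) 0 v = ![v, t, o] := by
  funext r; fin_cases r <;> rfl

/-- Writing register `1`. [folklore] -/
@[simp] theorem update_vec_one :
    Function.update (![i, t, o] : Regs (Fin 3)) 1 v = ![i, v, o] := by
  funext r; fin_cases r <;> rfl

/-- Writing register `2`. [folklore] -/
@[simp] theorem update_vec_two :
    Function.update (![i, t, o] : Regs (Fin 3)) 2 v = ![i, t, v] := by
  funext r; fin_cases r <;> rfl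

end FileLemmas

/-- `Regs.init 0 w` as a vector. [folklore] -/
theorem init_zero_eq (w : List Bool) : Regs.init (0 : Fin 3) w = ![w, [], []] := by
  funext r; fin_cases r <;> rfl

/-- `Regs.init 2 w` as a vector. [folklore] -/
theorem init_two_eq (w : List Bool) : Regs.init (2 : Fin 3) w = ![[], [], w] := by
  funext r; fin_cases r <;> rfl

/-! ### Simulation of the program pieces -/

/-- The three pushes `b`, `true`, `false` on the output register, in `3` steps. [folklore] -/
theorem runs_tail3 (b : Bool) (i t o : List Bool) :
    Runs (push (2 : Fin 3) b ;; push 2 true ;; push 2 false) (![i, t, o] : Regs (Fin 3))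
      ![i, t, false :: true :: b :: o] 3 :=
  ((Runs.push _ _ _).seq ((Runs.push _ _ _).seq (Runs.push _ _ _))).of_eq (by simp) (by norm_num)

/-- The head of the program: pop the leading bit `b` off the input register and push `b`, `true`,
`false` on the output register, in `5` steps. [folklore] -/
theorem runs_head (b : Bool) (st t o : List Bool) :
    Runs (pop (0 : Fin 3) (push 2 true ;; push 2 true ;; push 2 false)
        (push 2 false ;; push 2 true ;; push 2 false) skip)
      (![b :: st, t, o] : Regs (Fin 3)) ![st, t, false :: true :: b :: o] 5 := by
  cases b
  · exact Runs.pop_false' (R := (![false :: st, t, o] : Regs (Fin 3))) (w := st) _ _ rfl (by simp)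
      (runs_tail3 false st t o)
  · exact Runs.pop_true' (R := (![true :: st, t, o] : Regs (Fin 3))) (w := st) _ _ rfl (by simp)
      (runs_tail3 true st t o)

-- adapted from Literature/Computability/Complexity/Williams2014MachineBPlumbing.lean (`runs_dblLoop`)
/-- The doubling loop: pour register `1` onto register `2` doubling every bit, so that register `2`
becomes `(reverse l).flatMap (b ↦ bb) ++ o`, in `4|l| + 1` steps. [folklore] -/
theorem runs_dblLoop (l i o : List Bool) :
    Runs (loop (1 : Fin 3) (push 2 true ;; push 2 true) (push 2 false ;; push 2 false))
      (![i, l, o] : Regs (Fin 3)) ![i, [], (l.reverse.flatMap fun b => [b, b]) ++ o]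
      (4 * l.length + 1) := by
  induction l generalizing o with
  | nil => exact (Runs.loop_nil _ _ (by rfl)).of_eq (by simp) (by simp)
  | cons b l ih =>
    have hbody : ∀ b : Bool, Runs (push (2 : Fin 3) b ;; push 2 b) (![i, l, o] : Regs (Fin 3))
        ![i, l, b :: b :: o] (1 + 1) := fun b =>
      ((Runs.push _ _ _).seq (Runs.push _ _ _)).of_eq (by simp) le_rfl
    have hfin : (l.reverse.flatMap fun b => [b, b]) ++ (b :: b :: o) =
        ((b :: l).reverse.flatMap fun b => [b, b]) ++ o := by
      simp [List.flatMap_append]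
    cases b
    · exact (Runs.loop_false' (by rfl) (by simp) (hbody false) (ih (false :: false :: o))).of_eq
        (by rw [hfin]) (by simp; omega)
    · exact (Runs.loop_true' (by rfl) (by simp) (hbody true) (ih (true :: true :: o))).of_eq
        (by rw [hfin]) (by simp; omega)

/-- **Simulation of the pair former**: from `Regs.init 0 (b :: st)` to
`Regs.init 2 (boolPair st [b])` in `7|st| + 7` steps. [Arora–Barak 2009, §0.1, §1.3] [folklore] -/
theorem runs_pairFormer (b : Bool) (st : List Bool) :
    Runs (pop (0 : Fin 3) (push 2 true ;; push 2 true ;; push 2 false)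
          (push 2 false ;; push 2 true ;; push 2 false) skip ;;
        pour 0 1 ;; loop 1 (push 2 true ;; push 2 true) (push 2 false ;; push 2 false))
      (Regs.init 0 (b :: st)) (Regs.init 2 (boolPair st [b])) (7 * st.length + 7) := by
  rw [init_zero_eq, init_two_eq]
  have h1 := runs_head b st [] []
  have h2 : Runs (pour (0 : Fin 3) 1) (![st, [], [false, true, b]] : Regs (Fin 3))
      ![[], st.reverse, [false, true, b]] (3 * st.length + 1) :=
    (runs_pour (a := (0 : Fin 3)) (b := 1) (by decide) _).of_eq (by simp) (by simp)
  have h3 := runs_dblLoop st.reverse [] [false, true, b]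
  refine (h1.seq (h2.seq h3)).of_eq ?_ ?_
  · rw [List.reverse_reverse]
    simp [boolPair]
  · simp only [List.length_reverse]
    omega

end PairFormer

/-- **Stub C (pair former).** One Boolean `TM2` machine maps `b :: st` to the tree's pairing
`boolPair st [b] = dbl st ++ [false, true, b]` in linear time (a `Com` stack program over `Fin 3`:
pop the bit and push the three trailing symbols, pour, pour back doubling every bit; compiled by
`Com.outputsWithin_of_runs_equiv`). [Arora–Barak 2009, §0.1 (pairing), §1.3] [folklore] -/
theorem stub_pairFormer :
    ∃ (M : Turing.TM2ComputableAux Bool Bool) (d : ℕ),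
      ∀ (b : Bool) (st : List Bool),
        M.OutputsWithin (b :: st) (Literature.Computability.Complexity.boolPair st [b])
          (d * st.length + d) := by
  -- the machine (first witness) is read off by unification from `Com.outputsWithin_of_runs_equiv`
  exact ⟨_, 8, fun b st =>
    (Com.outputsWithin_of_runs_equiv (Equiv.refl (Fin 3))
      (Or.inl (PairFormer.runs_pairFormer b st))).mono (by omega)⟩

end Summit.PneNP.PneNP.Theorems.UniformStreamLB.Birth
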